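import Mathlib
import Literature.AlgebraicGeometry.Resolution.WeightedShear
import Summits.ResolutionOfSingularities.ResolutionOfSingularities.Theorems.WeightedInvariantLocalWeightedDropWildMonicFlagN0Transport
import Summits.ResolutionOfSingularities.ResolutionOfSingularities.Theorems.WeightedInvariantLocalWeightedDropWildMonicNewtonPointStep
import Summits.ResolutionOfSingularities.ResolutionOfSingularities.Theorems.WeightedInvariantLocalWeightedDropWildMonicSCleanShift

/-!
# `WeightedInvariant.LocalWeightedDrop`, line `hasse-ridge-face-selection`, S3ρ sub-stub S3ρD `stub_wildMonicSurfaceDescent`: item D-0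
# «maximising flag» — THE DICTIONARY `(dRes, excExp) ↔ (wMin (1,1), wMin (1,0), wMin (0,1))` (the setting as three weighted orders)

Crux item stmt-ResolutionOfSingularities-8899 `LocalWeightedDrop` (route `ResolutionOfSingularities/WeightedInvariant`), engine of the door
`HypersurfaceCentreConstruction` stmt-ResolutionOfSingularities-19897.  [OURS · L1 W4.3, chain w43, res-L1-w43-stub-3 (gen 3) on roadmap item
D-0 of `L/res-L1-w43-stub-7/S3RHOD-ROADMAP.md` (owners res-type-083 / stub-7); spec `L/res-L1-w43-stub-3/D0-SPEC.md` §8 (D-0d (α2)).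
MODEL: Perlega, arXiv:2011.14443 Ch. 5 §1–§3: the «setting» `J₋₁ = (x^r)·I₋₁`, `ord I₋₁ = d` of a coefficient ideal is the data
`(r, d)` = (`excExp`, `dRes`) of stub-7's `…WildMonicFlagDefs`; Perlega controls it under coordinate changes through the weighted orders
`ord`, `ord_{(x)}`, `ord_{(y)}` (Lemma 5.1.6 `m_under_coord_changes` for the weights `(1,1)`, `(1,0)`, `(0,1)`), i.e. through res-type-083's
`WildMonic.wMin`.  This file is the bookkeeping between the two descriptions (folklore on stub-7's `newtonSet`; definition-free), so that
the completeness theorem `exists_limit_mem_wMinClass` (`…WildMonicFlagComplete`, classes cut out by `wMin` values) feeds the attainment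
theorem `exists_isGreatest_sFlag_shift_of_complete` (`…WildMonicFlagAttainRecentre`, classes cut out by `(dRes, excExp)`).]

* `le_wMin_iff_newtonSet` — `x ≤ wMin w A ⟺ x ≤ w(P)` for every scaled Newton point `P`; `wMin_eq_top_iff_newtonSet`;
  `toNat_wMin_eq_sInf` — `wMin w A` is the least `w(P)` (as `ℕ∞`, `⊤` for the zero tuple);
* `alphaL_newtonSet` / `epsL_newtonSet` / `deltaL_newtonSet` — CJS's `2α`, `2ε`, `2δ` of the scaled Newton set are `toNat` of
  `wMin (1,0)`, `wMin (0,1)`, `wMin (1,1)`;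
* **`excExp_newtonSet_eq`**, **`dRes_newtonSet_eq`** — `r_i = [i ∈ E]·toNat (wMin e_i)`, `dRes = toNat (wMin (1,1)) − r₀ − r₁`;
  **`excExp_eq_of_wMin_eq`** / **`dRes_eq_of_wMin_eq`** — equal `wMin`'s (those the boundary `E` sees, and `(1,1)`) give equal settings;
  **`wMin_eq_of_newtonSet_nonempty`** — conversely the setting of a non-zero tuple gives back the three `wMin`'s.
-/

set_option linter.dupNamespace false -- mandated namespace of this single-conjunct summit

namespace Summit.ResolutionOfSingularities.ResolutionOfSingularities.Theorems

namespace WildMonic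

open MvPowerSeries MonicDescent
open Literature.AlgebraicGeometry.Resolution

variable {k : Type} [Field k] {d : ℕ}

/-! ### `wMin` on the scaled Newton set -/

/-- `x ≤ wMin w A` iff `x ≤ w(P)` for every point `P` of the scaled Newton set. -/
theorem le_wMin_iff_newtonSet (w : Fin 2 → ℕ) (A : Fin d → MvPowerSeries (Fin 2) k) {x : ℕ∞} :
    x ≤ wMin w A ↔ ∀ P ∈ newtonSet A, x ≤ (Finsupp.weight w P : ℕ∞) := by
  unfold wMin
  rw [le_iInf_iff]
  constructor
  · intro h P hP
    obtain ⟨j, e, he, rfl⟩ := (mem_newtonSet_iff A P).1 hP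
    have h1 := (le_slotWOrd_iff A w j).1 (h j) e he
    rwa [map_nsmul, smul_eq_mul]
  · intro h j
    rw [le_slotWOrd_iff]
    intro e he
    have h1 := h _ ((mem_newtonSet_iff A _).2 ⟨j, e, he, rfl⟩)
    rwa [map_nsmul, smul_eq_mul] at h1

/-- `wMin w A = ⊤` iff the scaled Newton set is empty (the zero tuple). -/
theorem wMin_eq_top_iff_newtonSet (w : Fin 2 → ℕ) (A : Fin d → MvPowerSeries (Fin 2) k) :
    wMin w A = ⊤ ↔ newtonSet A = ∅ := by
  constructor
  · intro h
    by_contra hne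
    obtain ⟨P, hP⟩ := Set.nonempty_iff_ne_empty.2 hne
    have h1 := (le_wMin_iff_newtonSet w A).1 h.ge P hP
    exact absurd h1 (not_le.mpr (ENat.coe_lt_top _))
  · intro h
    exact top_le_iff.mp ((le_wMin_iff_newtonSet w A).2 fun P hP => by simp [h] at hP)

/-- `wMin w A`, read in `ℕ` (`0` for the zero tuple), is the least weight `w(P)` over the scaled Newton set. -/
theorem toNat_wMin_eq_sInf (w : Fin 2 → ℕ) (A : Fin d → MvPowerSeries (Fin 2) k) :
    (wMin w A).toNat = sInf ((fun P => Finsupp.weight w P) '' newtonSet A) := by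
  by_cases hN : newtonSet A = ∅
  · rw [(wMin_eq_top_iff_newtonSet w A).2 hN, hN, Set.image_empty, Nat.sInf_empty, ENat.toNat_top]
  · have hne : (newtonSet A).Nonempty := Set.nonempty_iff_ne_empty.2 hN
    obtain ⟨P₀, hP₀, hP₀eq⟩ := Nat.sInf_mem (hne.image (fun P => Finsupp.weight w P))
    have hle : wMin w A ≤ (Finsupp.weight w P₀ : ℕ∞) := (le_wMin_iff_newtonSet w A).1 le_rfl P₀ hP₀
    have hge : ((sInf ((fun P => Finsupp.weight w P) '' newtonSet A) : ℕ) : ℕ∞) ≤ wMin w A :=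
      (le_wMin_iff_newtonSet w A).2 fun P hP => by
        exact_mod_cast Nat.sInf_le (Set.mem_image_of_mem (fun P => Finsupp.weight w P) hP)
    change Finsupp.weight w P₀ = sInf ((fun P => Finsupp.weight w P) '' newtonSet A) at hP₀eq
    rw [hP₀eq] at hle
    rw [le_antisymm hle hge, ENat.toNat_coe]

/-- CJS's `2α` of the scaled Newton set is `wMin (1,0)`. -/
theorem alphaL_newtonSet (A : Fin d → MvPowerSeries (Fin 2) k) : alphaL (newtonSet A) = (wMin ![1, 0] A).toNat := by
  have h : (fun P : Fin 2 →₀ ℕ => P 0) = fun P => Finsupp.weight ![1, 0] P := by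
    funext P; rw [WeightedShear.weight_fin_two]; ring
  rw [toNat_wMin_eq_sInf, alphaL, h]

/-- CJS's `2ε` of the scaled Newton set is `wMin (0,1)`. -/
theorem epsL_newtonSet (A : Fin d → MvPowerSeries (Fin 2) k) : epsL (newtonSet A) = (wMin ![0, 1] A).toNat := by
  have h : (fun P : Fin 2 →₀ ℕ => P 1) = fun P => Finsupp.weight ![0, 1] P := by
    funext P; rw [WeightedShear.weight_fin_two]; ring
  rw [toNat_wMin_eq_sInf, epsL, h]

/-- CJS's `2δ` of the scaled Newton set is `wMin (1,1)`. -/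
theorem deltaL_newtonSet (A : Fin d → MvPowerSeries (Fin 2) k) : deltaL (newtonSet A) = (wMin ![1, 1] A).toNat := by
  have h : (fun P : Fin 2 →₀ ℕ => P 0 + P 1) = fun P => Finsupp.weight ![1, 1] P := by
    funext P; rw [WeightedShear.weight_fin_two]; ring
  rw [toNat_wMin_eq_sInf, deltaL, h]

/-! ### The setting from the three `wMin`'s, and back -/

/-- **`r_i = [i ∈ E] · wMin e_i`**: the exceptional exponents of the scaled Newton set. -/
theorem excExp_newtonSet_eq (E : Finset (Fin 2)) (A : Fin d → MvPowerSeries (Fin 2) k) :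
    excExp E (newtonSet A) = Finsupp.single 0 (if (0 : Fin 2) ∈ E then (wMin ![1, 0] A).toNat else 0) +
      Finsupp.single 1 (if (1 : Fin 2) ∈ E then (wMin ![0, 1] A).toNat else 0) := by
  rw [excExp, alphaL_newtonSet, epsL_newtonSet]

/-- **`dRes = wMin (1,1) − r₀ − r₁`**: the residual order of the scaled Newton set (junk-compatible: all zero for the zero tuple). -/
theorem dRes_newtonSet_eq (E : Finset (Fin 2)) (A : Fin d → MvPowerSeries (Fin 2) k) :
    dRes E (newtonSet A) = (wMin ![1, 1] A).toNat - excExp E (newtonSet A) 0 - excExp E (newtonSet A) 1 := by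
  by_cases hN : newtonSet A = ∅
  · have h1 : dRes E (newtonSet A) = 0 := by
      rw [dRes, hN, reduce, Set.image_empty, deltaL, Set.image_empty, Nat.sInf_empty]
    rw [h1, (wMin_eq_top_iff_newtonSet _ A).2 hN, ENat.toNat_top]
    simp
  · have h := dRes_add_excExp E (Set.nonempty_iff_ne_empty.2 hN)
    rw [deltaL_newtonSet] at h
    omega

/-- **EQUAL `wMin`'S GIVE EQUAL EXCEPTIONAL EXPONENTS** (only the weights the boundary sees are needed). -/
theorem excExp_eq_of_wMin_eq (E : Finset (Fin 2)) {A A' : Fin d → MvPowerSeries (Fin 2) k}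
    (h10 : (0 : Fin 2) ∈ E → wMin ![1, 0] A = wMin ![1, 0] A') (h01 : (1 : Fin 2) ∈ E → wMin ![0, 1] A = wMin ![0, 1] A') :
    excExp E (newtonSet A) = excExp E (newtonSet A') := by
  rw [excExp_newtonSet_eq, excExp_newtonSet_eq]
  congr 2
  · split_ifs with h
    · rw [h10 h]
    · rfl
  · split_ifs with h
    · rw [h01 h]
    · rfl

/-- **EQUAL `wMin`'S GIVE EQUAL RESIDUAL ORDERS.** -/
theorem dRes_eq_of_wMin_eq (E : Finset (Fin 2)) {A A' : Fin d → MvPowerSeries (Fin 2) k}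
    (h10 : (0 : Fin 2) ∈ E → wMin ![1, 0] A = wMin ![1, 0] A') (h01 : (1 : Fin 2) ∈ E → wMin ![0, 1] A = wMin ![0, 1] A')
    (h11 : wMin ![1, 1] A = wMin ![1, 1] A') : dRes E (newtonSet A) = dRes E (newtonSet A') := by
  rw [dRes_newtonSet_eq, dRes_newtonSet_eq, excExp_eq_of_wMin_eq E h10 h01, h11]

/-- **CONVERSELY**, for a NON-ZERO tuple the setting gives back the three weighted orders:
`wMin (1,1) = dRes + r₀ + r₁`, `wMin (1,0) = r₀` if `0 ∈ E`, `wMin (0,1) = r₁` if `1 ∈ E`. -/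
theorem wMin_eq_of_newtonSet_nonempty (E : Finset (Fin 2)) (A : Fin d → MvPowerSeries (Fin 2) k) (hN : (newtonSet A).Nonempty) :
    wMin ![1, 1] A = ((dRes E (newtonSet A) + excExp E (newtonSet A) 0 + excExp E (newtonSet A) 1 : ℕ) : ℕ∞) ∧
      ((0 : Fin 2) ∈ E → wMin ![1, 0] A = (excExp E (newtonSet A) 0 : ℕ∞)) ∧
      ((1 : Fin 2) ∈ E → wMin ![0, 1] A = (excExp E (newtonSet A) 1 : ℕ∞)) := by
  have hne : newtonSet A ≠ ∅ := Set.nonempty_iff_ne_empty.1 hN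
  have hfin : ∀ w : Fin 2 → ℕ, wMin w A = ((wMin w A).toNat : ℕ∞) := fun w =>
    (ENat.coe_toNat (by rw [Ne, wMin_eq_top_iff_newtonSet]; exact hne)).symm
  refine ⟨?_, fun h0 => ?_, fun h1 => ?_⟩
  · rw [dRes_add_excExp E hN, deltaL_newtonSet, ← hfin]
  · rw [excExp_apply_zero, if_pos h0, alphaL_newtonSet, ← hfin]
  · rw [excExp_apply_one, if_pos h1, epsL_newtonSet, ← hfin]

/-- A tuple with POSITIVE residual order is non-zero (its scaled Newton set is non-empty). -/
theorem newtonSet_nonempty_of_dRes_pos (E : Finset (Fin 2)) (A : Fin d → MvPowerSeries (Fin 2) k)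
    (h : 0 < dRes E (newtonSet A)) : (newtonSet A).Nonempty := by
  by_contra hN
  rw [Set.not_nonempty_iff_eq_empty] at hN
  rw [dRes, hN, reduce, Set.image_empty, deltaL, Set.image_empty, Nat.sInf_empty] at h
  exact absurd h (lt_irrefl 0)

end WildMonic

end Summit.ResolutionOfSingularities.ResolutionOfSingularities.Theorems
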